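import Summits.BirchSwinnertonDyer.Rank1Residual.O6.X3KatoMemberBoundExactCount
import HarnessLib

/-!
# O6 / X3: the UPPER HALF on EVERY reducible additive potentially good row of analytic rank `0` — T-X3K
# with no torsion slack, T-X3K♯ and (I-X3t)♭ WITHOUT their `ℤ/p²` / parity hypotheses — over the
# sharpened hull readings (cell `bsd-potss`, seat `kmc`, generation 7; part 14, consequences file)

From the exact rank-`0` count at Kato's member (`X3KatoMemberBoundExactCount.lean`: Reading M3♯,
`ord_p #Ш_an(W_K) = ord_p #Ш(W_K) + m`, `m ≥ 0` under the divisibility for the hull) the Euler-system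
half `ord_p #Ш ≤ ord_p #Ш_an` holds AT `W_K` with NO slack, and Cassels' isogeny invariance of the BSD
quotient (tree `TwistComparison.missingUpperBoundAt_of_isIsogenous`) carries it to every member. So on
every reducible additive potentially good `r_an = 0` row the upper half follows from Reading M1 (Kato's
member carries a realised hull datum), Reading M2 (divisibility for the hull: Thm. 12.5 (3) off `(p)`,
Wuthrich's Lemma 14 at `(p)`), Reading M3♯, and the named facts Cassels / GZK / modularity — the SAME
inputs as crux M (`ReducibleKatoMember`). In particular o6-r1 GEN 21's census-facing node T-X3K♯
(`X3PotGoodRankZeroUpperOfSmallClassTorsion`) and its RESIDUAL CONJECTURE (I-X3t)♭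
(`X3PotGoodRankZeroUpperOfLargeClassTorsion`: the classes with a `ℤ/p²` member — 54b, 1890r, 122094bl at
`p = 3`) follow with their torsion and parity hypotheses UNUSED, and the reducible-defect children of the
route cruxes U₀ (`WildUpperReducibleDefect`, `TameUpperReducibleDefect`) are covered (Theorems-side
helper files). CONDITIONAL over displayed readings / named facts (audit `proof.conditional`); no node or
item is closed; nothing is booked.

References: [Kato2004Asterisque] Thm. 12.5 (3), 12.6 (p. 222), §14.14 (p. 243), Prop. 14.16 (2) (p. 244);
[Wuthrich2014] §3.2, Lemma 14 (pp. 394–396); [Cassels1965ArithmeticVIII]; [MilneADT2006] I.7.3;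
[Miller2011LMS] Def. 1.1.
-/

set_option autoImplicit false

noncomputable section

open scoped Classical

open WeierstrassCurve Literature.NumberTheory.EllipticCurves
  Literature.NumberTheory.EllipticCurves.ModularForms
  Literature.NumberTheory.EllipticCurves.Rank1Residual
  Literature.NumberTheory.EllipticCurves.Rank1Residual.Typed
  Literature.NumberTheory.EllipticCurves.IwasawaAlgebra

namespace Summit.BirchSwinnertonDyer.Rank1Residual

open Additive

variable {IsHullOf : ∀ (W : WeierstrassCurve ℚ) [W.IsElliptic] [W.IsGloballyMinimal] (p : ℕ)
  [Fact p.Prime], KatoHullDescentDatum p → Prop}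

/-- **THE UPPER HALF ON EVERY REDUCIBLE ADDITIVE POTENTIALLY GOOD ROW OF ANALYTIC RANK `0`** — T-X3K
with `3t` sharpened to `2t`, i.e. WITHOUT slack, transported to every member: over Reading M1 (Kato's
member `W_K ∼ W` carries a realised hull datum), Reading M2 (divisibility for the hull on reducible
rows: Thm. 12.5 (3) off `(p)`, Wuthrich's Lemma 14 at `(p)`), Reading M3♯ (the exact count), and the
named facts Cassels (isogeny invariance of the BSD quotient), GZK, modularity:
`MissingUpperBoundAt W p` for EVERY globally minimal `W` with `p ≠ 2` additive potentially good, `W[p]`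
reducible and `r_an = 0` — no `ℤ/p²`-member or parity hypothesis. Proof: the upper half at `W_K`
(`missingUpperBoundAt_of_exactCount`) and `TwistComparison.missingUpperBoundAt_of_isIsogenous`.
Conditional over displayed readings; nothing asserted.
[cite: Kato2004Asterisque, Thm. 12.6 (p. 222), §14.14 (p. 243), Prop. 14.16 (2) (p. 244)]
[cite: Wuthrich2014, §3.2 Lemma 11–12 (pp. 394–395), Lemma 14 (p. 396)] [cite: Cassels1965ArithmeticVIII] -/
theorem O6.x3PotGoodRankZeroUpper_of_hullReadingsSharp (hM : KatoHull.MemberRealizable IsHullOf)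
    (hD : KatoHull.DivisibilityReading IsHullOf) (hC : KatoHull.ExactCountReading IsHullOf)
    (hCassels : bsdRHS_eq_of_isIsogenous) (hGZK : rank_eq_analyticRank_of_analyticRank_le_one)
    (hmod : hasEntireLFunction_rat)
    (W : WeierstrassCurve ℚ) [W.IsElliptic] [W.IsGloballyMinimal] (p : ℕ) [Fact p.Prime]
    (hp : p ≠ 2) (hng : ¬ W.HasGoodReductionAtPrime p) (hnm : ¬ W.HasMultiplicativeReductionAtPrime p)
    (hj : 0 ≤ padicValRat p W.j) (hred : ¬ W.HasIrreducibleModPGaloisRep p)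
    (hr : W.analyticRank = 0) : MissingUpperBoundAt W p := by
  obtain ⟨W', hE', hM', hiso, D, hDof⟩ := hM W p hp ⟨hng, hnm⟩ hj hred
  -- transport the hypotheses to Kato's member `W'`
  obtain ⟨hadd', hj'⟩ := Addv.of_isIsogenous_of_padicValRat_j_nonneg (p := p) ⟨hng, hnm⟩ hj hiso
  have hred' : ¬ W'.HasIrreducibleModPGaloisRep p :=
    (X2.red_iff_of_isIsogenous (p := p) hiso).mp hred
  have hr' : W'.analyticRank = 0 := by rw [← analyticRank_eq_of_isIsogenous' hiso, hr]
  have hdiv : D.HullDivisibility := hD W' p D hp hadd' hj' hred' hDof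
  -- the upper half at `W'`, transported back to `W` by Cassels
  have hup' : MissingUpperBoundAt W' p :=
    KatoHull.missingUpperBoundAt_of_exactCount hC hGZK hmod hp hadd' hj' hr' hDof hdiv
  exact TwistComparison.missingUpperBoundAt_of_isIsogenous W' W p hCassels hGZK hmod
    hiso.symm_of_isElliptic (by rw [hr']; exact zero_le_one) hup'

/-- **T-X3K♯ (`X3PotGoodRankZeroUpperOfSmallClassTorsion`) over the sharpened hull readings** — its
torsion and parity hypotheses are not used. Conditional; nothing asserted.
[cite: Kato2004Asterisque, Thm. 12.6 (p. 222), Prop. 14.16 (2) (p. 244)] [cite: Wuthrich2014, Lemma 14 (p. 396)] -/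
theorem O6.x3PotGoodRankZeroUpperOfSmallClassTorsion_of_hullReadingsSharp
    (hM : KatoHull.MemberRealizable IsHullOf) (hD : KatoHull.DivisibilityReading IsHullOf)
    (hC : KatoHull.ExactCountReading IsHullOf) (hCassels : bsdRHS_eq_of_isIsogenous)
    (hGZK : rank_eq_analyticRank_of_analyticRank_le_one) (hmod : hasEntireLFunction_rat) :
    O6.X3PotGoodRankZeroUpperOfSmallClassTorsion := by
  intro W _ _ p _ hp hng hnm hj hred hr _ _
  exact O6.x3PotGoodRankZeroUpper_of_hullReadingsSharp hM hD hC hCassels hGZK hmod W p hp hng hnm hj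
    hred hr

/-- **(I-X3t)♭ (`X3PotGoodRankZeroUpperOfLargeClassTorsion`, the `ℤ/p²`-member RESIDUAL CONJECTURE of
o6-r1 GEN 21) over the sharpened hull readings** — "the missing input is `μ(λ_{W_K}) ≥ t(W_K)`" is
not needed: the exact count has no torsion slack. Conditional; nothing asserted.
[cite: Kato2004Asterisque, Conj. 12.10 (p. 224), Prop. 14.16 (2) (p. 244)] [cite: Wuthrich2014, Lemma 14 (p. 396)] -/
theorem O6.x3PotGoodRankZeroUpperOfLargeClassTorsion_of_hullReadingsSharp
    (hM : KatoHull.MemberRealizable IsHullOf) (hD : KatoHull.DivisibilityReading IsHullOf)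
    (hC : KatoHull.ExactCountReading IsHullOf) (hCassels : bsdRHS_eq_of_isIsogenous)
    (hGZK : rank_eq_analyticRank_of_analyticRank_le_one) (hmod : hasEntireLFunction_rat) :
    O6.X3PotGoodRankZeroUpperOfLargeClassTorsion := by
  intro W _ _ p _ hp hng hnm hj hred hr _ _
  exact O6.x3PotGoodRankZeroUpper_of_hullReadingsSharp hM hD hC hCassels hGZK hmod W p hp hng hnm hj
    hred hr

/-- **T-X3K (`O6.KatoMemberShaBoundOfReducible`, the crux `ReducibleKatoMember`) over the sharpened
readings** (via part 12: Reading M3♯ implies Reading M3). Conditional; nothing asserted.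
[cite: Kato2004Asterisque, Thm. 12.6 (p. 222), Prop. 14.16 (2) (p. 244)] [cite: Wuthrich2014, Lemma 14 (p. 396)] -/
theorem O6.katoMemberShaBoundOfReducible_of_hullReadingsSharp
    (hM : KatoHull.MemberRealizable IsHullOf) (hD : KatoHull.DivisibilityReading IsHullOf)
    (hC : KatoHull.ExactCountReading IsHullOf) : O6.KatoMemberShaBoundOfReducible :=
  O6.katoMemberShaBoundOfReducible_of_hullReadings hM hD
    (KatoHull.countReading_of_exactCountReading IsHullOf hC)

end Summit.BirchSwinnertonDyer.Rank1Residual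

end
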